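import Summits.HodgeConjecture.HodgeConjecture.Theorems.F0P3APacketMembersOfT5      -- ★ `aPacketMembersGuarded_of_T5` (typ-T4a): record-packet membership for SOME `ξ₀` (T5 V8 chain)
import Summits.HodgeConjecture.HodgeConjecture.Theorems.F0P3XiRigid                  -- ★ `memXiFamily_rigid` (U♭ of record): `MemXiFamily P ξ → MemXiFamily P ξ′ → ξ = ξ′`
import Summits.HodgeConjecture.HodgeConjecture.Theorems.F0P3SLayerFoldShapes         -- ★ `exists_cohToken_of_isHolOrAntihol_cpt`: the `(𝔤,K)`-token of a cotangent `P`
import Summits.HodgeConjecture.HodgeConjecture.Theorems.F0P3CompactTrivOfRecord      -- ★ `cmCompactFactor_rightRegular_eq_self_of_isHolOrAntihol` (`Kc`-triviality, both halves)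
import Summits.HodgeConjecture.HodgeConjecture.Theorems.F0P3FinRepConstituentsExist  -- ★ `isConstituentOf_finRepSmooth_comp_of_hasFinComponent` (`σ ↦ P.finRep.smoothPart`)
import HarnessLib

/-!
# Crux `H413`, programme P2 — the MEM half of PKΠ's `stub_D7αMemDock`, KIT-GENERICALLY and for EVERY `ξ`:
# a local constituent of a cotangent `P ∈ Π′(ξ)` lies in the kit's A-packet `packFin ξ v` at every finite place

Cell `hodgecm-mathlib` (D-0151), FLOOR 0, crux item H413 = `stmt-HodgeConjecture-24833`, route of record `HCCMUnconditional`; programme P2, fallback road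
PKΠ `Cruxes/H413/Lines/F0_P2PKPiRung4.lean` (v1.12), registered engine stub `stub_D7αMemDock : StubD7αMemDock` — ONE joint ∃ over the record data
`(Δ, mH, mG, νG, νH, ξloc, μZ, keys, hCM)` of (DOCK) the theta-docking clause and (MEM) «every local constituent class of a cotangent `P`'s finite
component at a non-split `v` lies in the packet OF RECORD ★ `xiPacketFamilyOfRecord … ξ v` of EVERY `ξ` with `MemXiFamily P … ξ`» [Rogawski1990 Thm. 13.3.7, §14.6].
F0P2-p01 (g9), split «MEM ∕ DOCK» with F0P2-p02 (g8) (P2 bus 2026-09-01T01:25:42Z); census `F0/P2/p01/g9/CENSUS-D7alpha-MEM.F0P2p01g9.md`.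
Helper file: THEOREMS ONLY (no definition, no named fact, no instance declaration or attribute — the `(𝔤,K)`-token binders are only ever OBTAINED from ★ terms,
never stated, so the `LieRing.ofAssociativeRing` idiom is not needed — no notation, no `sorry`); `--supports stmt-HodgeConjecture-24833 --as helper`.
HONEST LABEL: HC_CM is proved only modulo the printed citations until rung 0 closes; this file discharges none of them — it is kit-generic over T5's pins + laws
exactly like ★ `aPacketMembersGuarded_of_T5`, and says something about the actual `U(H)` only at the closer's kit family of record `𝔎₀` (whose laws ARE the closer's letters).

THE POINT.  ★ `F0P3APacketMembersOfT5.aPacketMembersGuarded_of_T5` (typ-T4a) exports the membership clause of Thm. 14.6.4 from the T5 engine: for a cotangent-type,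
`Kc`-trivial, token-carrying discrete `P` there is SOME `ξ₀` with every finite local constituent of `P` in `(𝔎 …).packFin ξ₀ v` and `MemXiFamily P … ξ₀`.  PKΠ's stub wants
it (i) for EVERY `ξ` with `MemXiFamily P … ξ` (the `ξ` PKΠ receives from the letter S2♯ is an arbitrary D6 envelope witness), (ii) for a cotangent `P` given with an
irreducible smooth finite component `σ` and NO token ∕ `Kc` data, (iii) for the constituents of `σ_v` rather than of `P.finRep.smoothPart`.  All three gaps (B-p14 (g27)'s
census (ii)(α)(β)) are ★ today: (i) is family rigidity U♭ ★ `F0P3XiRigid.memXiFamily_rigid` (the split member determines `ξ`: Zelevinsky rigidity at the definite split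
witness + weak approximation for `U(1)`), (ii) is ★ `F0P3SLayerFoldShapes.exists_cohToken_of_isHolOrAntihol_cpt` + ★ `F0P3CompactTrivOfRecord.cmCompactFactor_rightRegular_eq_self_of_isHolOrAntihol`,
(iii) is ★ `F0P3FinRepConstituentsExist.isConstituentOf_finRepSmooth_comp_of_hasFinComponent`.  Hence:

* §1 `mem_packFin_of_memXiFamily_of_T5 (𝔎) (hpin) (hlaws)` — for every letters' frame, every `(W, σ)` irreducible smooth, every cotangent `P` with `P.HasFinComponent σ`,
  EVERY `ξ` with `MemXiFamily P … ξ`, every finite `v` (split or not) and every class `c` of `U(H)(L⁺_v)` occurring in `σ ∘ inclPlace v`: `c ∈ ((𝔎 …).packFin ξ v).members`.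
  At the closer's `𝔎₀ = kitFamilyOfRecord 𝔇₀` (`Lines/F0_U3LettersRung1.lean` §D) `packFin ξ v` IS `xiPacketFamilyOfRecord L H hH hHd μω hμu Δ mH mG νG νH ξloc μZ keys hCM ξ v` at the
  record data (★ `F0P3XiSideOfRecord.xiSideOfRecord`, `rfl`) — i.e. §1 at `𝔎₀` is the MEM conjunct of `StubD7αMemDock` (and more: all finite `v`, no admissibility).
* §2 `exists_xi_mem_packFin_of_T5` — the `∃ ξ₀` form at the stub's binders (no `ξ` given): token + `Kc` discharged, constituents read on `σ`.

References: [Rogawski1990] §13.1 p. 199; Thm. 13.3.7; §13.3 p. 201; §14.6 Thm. 14.6.4 pp. 244–246; §15.3 ¶1; Prop. 15.2.1 (b).  [Zelevinsky1980] Thm. 4.2.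
[BorelWallach2000] VI Thm. 4.11.  [PlatonovRapinchuk1994] §7.3 Prop. 7.8.
-/

set_option autoImplicit false
-- the mandated namespace repeats `HodgeConjecture.HodgeConjecture`, as in every `Theorems/*.lean` of this sub-problem
set_option linter.dupNamespace false

noncomputable section

open NumberField IsDedekindDomain MeasureTheory
open scoped Matrix ComplexOrder

namespace Summit.HodgeConjecture.HodgeConjecture.Cruxes.H413.F0P2oD7alphaMemOfT5

open Literature.NumberTheory.Rogawski1990 Literature.NumberTheory.GaloisRepresentations
open Literature.NumberTheory.Automorphic Literature.NumberTheory.Automorphic.UnitaryGroup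
open Literature.NumberTheory.Automorphic.UnitaryGroup.CotangentForms
open Literature.RepresentationTheory.BorelWallach2000 Literature.RepresentationTheory.KonnoKonno2007
open Summit.HodgeConjecture.HodgeConjecture.Cruxes.H413.F0P3InnerFormClassificationV6 (Gp Places IsCot KcTrivial HasToken)
open Summit.HodgeConjecture.HodgeConjecture.Cruxes.H413.F0P3InnerFormClassificationV8

/-! ## §1 MEM for EVERY `ξ` with `MemXiFamily P … ξ` (kit-generic) -/

/-- **MEM, kit-generic, for every `ξ`.**  For a PINNED classification kit family with the laws: at every letters' frame `(L, ι, H, T)` (`H` definite off `ι`,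
`[L⁺:ℚ] ≥ 2`, `μω|_{𝕀_{L⁺}} = ω_{L/L⁺}`), for every irreducible smooth `σ` of `U(H)(𝔸_{L⁺,f})`, every discrete `P` of holomorphic or antiholomorphic cotangent
type at `ι` with `P.HasFinComponent σ`, EVERY one-dimensional automorphic `ξ` of `U(2) × U(1)` with `MemXiFamily P … ξ`, every finite place `v` of `L⁺` and every
class `c` of `U(H)(L⁺_v)` occurring in `σ ∘ inclPlace v`: `c` is a MEMBER of the kit's local A-packet `packFin ξ v` («`Π′ = Π′(ξ)`, `Π′(ξ_v) = Π(ξ_v)`»).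
Proof: the `(𝔤,K)`-token and the `Kc`-triviality of a cotangent `P` are ★; ★ `aPacketMembersGuarded_of_T5` gives `ξ₀` with membership and `MemXiFamily P … ξ₀`;
U♭ ★ `memXiFamily_rigid` forces `ξ = ξ₀`; constituents of `σ_v` are constituents of `P.finRep.smoothPart ∘ inclPlace v`.
[cite: Rogawski1990, §14.6 Thm. 14.6.4 p. 244; Thm. 13.3.7; §13.1 p. 199; §13.3 p. 201; §15.3 ¶1] [cite: Zelevinsky1980, Thm. 4.2] [cite: BorelWallach2000, VI Thm. 4.11] -/
theorem mem_packFin_of_memXiFamily_of_T5 (𝔎 : KitFamily) (hpin : KitFamily.IsPinned 𝔎) (hlaws : 𝔎.Laws) :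
    ∀ (L : Type) [Field L] [NumberField L] [IsCMField L] (ι : L →+* ℂ) (H : Matrix (Fin 3) (Fin 3) L) (T : GL (Fin 3) ℂ)
      (hT : (T : Matrix (Fin 3) (Fin 3) ℂ)ᴴ * H.map ι * (T : Matrix (Fin 3) (Fin 3) ℂ) = Literature.Geometry.ComplexHyperbolic.BallModel.J)
      (hdef : ∀ τ' : L →+* ℂ, InfinitePlace.mk τ' ≠ InfinitePlace.mk ι → (H.map τ').PosDef)
      (h2 : 2 ≤ Module.finrank ℚ ↥(maximalRealSubfield L))
      (μ : Measure (adelicGroupData (↥(maximalRealSubfield L)) L (IsCMField.complexConj L) 3 H).automorphicQuotient)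
      [(adelicGroupData (↥(maximalRealSubfield L)) L (IsCMField.complexConj L) 3 H).IsAutomorphicMeasure μ]
      (μω : HeckeCharacter L) (hμu : μω.IsUnitary)
      (hμω : ∀ x : Literature.NumberTheory.GaloisRepresentations.ideleGroup ↥(maximalRealSubfield L),
        μω (AdeleRing.ideleBaseChange (↥(maximalRealSubfield L)) L x) = quadraticHeckeCharCM L x)
      (W : Type) [AddCommGroup W] [Module ℂ W]
      (σ : Representation ℂ (finAdelic (↥(maximalRealSubfield L)) L (IsCMField.complexConj L) 3 H) W),
      σ.IsIrreducible → σ.IsSmooth →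
      ∀ (P : DiscreteAutomorphicRep (adelicGroupData (↥(maximalRealSubfield L)) L (IsCMField.complexConj L) 3 H) μ),
        (P.IsHolCotangentAt (cmArchSection L ι H T hT) (cmCompactFactor L ι H T hT) ∨
          P.IsAntiholCotangentAt (cmArchSection L ι H T hT) (cmCompactFactor L ι H T hT)) →
        P.HasFinComponent σ →
      ∀ (ξ : OneDimAutRepH L),
        MemXiFamily P (transpose_map_cmConjRingHom_eq_of_frame L ι H T hT) (isUnit_det_of_frame L ι H T hT) μω hμu ξ →
      ∀ (v : HeightOneSpectrum (𝓞 ↥(maximalRealSubfield L))) (c : IrrClass ((cmDatum L 3 H).Local v)),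
        (IrrClass.comap (localPiEquiv L (IsCMField.complexConj L) 3 H v) c).IsConstituentOf
            (σ.comp (inclPlace (↥(maximalRealSubfield L)) L (IsCMField.complexConj L) 3 H v)) →
        c ∈ ((𝔎 L ι H T hT hdef h2 μ μω hμu hμω).packFin ξ v).members := by
  intro L _ _ _ ι H T hT hdef h2 μ _ μω hμu hμω W _ _ σ hirr hsm P hP hPσ ξ hmem v c hc
  -- (ii) the `(𝔤,K)`-token of the cotangent `P` and its `Kc`-triviality (★)
  obtain ⟨M, iM₁, iM₂, σK, σ𝔤, hM, δ, hδ, hirrGK, hT₁, hne⟩ :=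
    F0P3SLayerFoldShapes.exists_cohToken_of_isHolOrAntihol_cpt L ι H T hT μ hdef h2 P hP
  have hKc : KcTrivial L H ι T hT μ P :=
    fun k hk w => F0P3CompactTrivOfRecord.cmCompactFactor_rightRegular_eq_self_of_isHolOrAntihol L ι H T hT P hP k hk w
  -- the membership clause of Thm. 14.6.4 for SOME `ξ₀` (★ typ-T4a export of the T5 engine)
  obtain ⟨ξ₀, -, hconst, -, hmem₀⟩ :=
    F0P3APacketMembersOfT5.aPacketMembersGuarded_of_T5 𝔎 hpin hlaws L ι H T hT hdef h2 μ μω hμu hμω P hP hKc M σK σ𝔤 hM hirrGK hT₁ δ hδ hne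
  -- (i) family rigidity U♭: `ξ = ξ₀`
  obtain rfl : ξ = ξ₀ :=
    F0P3XiRigid.memXiFamily_rigid (transpose_map_cmConjRingHom_eq_of_frame L ι H T hT) (isUnit_det_of_frame L ι H T hT) P hirr hsm hPσ
      μω hμu ξ ξ₀ hmem hmem₀
  -- (iii) constituents of `σ_v` are constituents of `P.finRep.smoothPart ∘ inclPlace v`
  exact hconst v c (F0P3FinRepConstituentsExist.isConstituentOf_finRepSmooth_comp_of_hasFinComponent P hsm hPσ hc)

/-! ## §2 The `∃ ξ₀` form at the stub's binders (token and `Kc` discharged, constituents read on `σ`) -/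

/-- **MEM, `∃ ξ₀` form.**  For a PINNED kit family with the laws, at every letters' frame: a cotangent discrete `P` with an irreducible smooth finite component `σ`
lies in `Π′(ξ₀)` for some `ξ₀` (`MemXiFamily P … ξ₀`) AND every class of `U(H)(L⁺_v)` occurring in `σ ∘ inclPlace v` is a member of `packFin ξ₀ v`, at every finite
`v` — ★ `aPacketMembersGuarded_of_T5` with its token ∕ `Kc` hypotheses discharged (★ `exists_cohToken_of_isHolOrAntihol_cpt`, ★ `cmCompactFactor_rightRegular_eq_self_of_isHolOrAntihol`)
and its constituent currency moved from `P.finRep.smoothPart` to `σ`. [cite: Rogawski1990, §14.6 Thm. 14.6.4 p. 244; §13.3 p. 201; §15.3 ¶1; Prop. 15.2.1 (b)]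
[cite: BorelWallach2000, VI Thm. 4.11] -/
theorem exists_xi_mem_packFin_of_T5 (𝔎 : KitFamily) (hpin : KitFamily.IsPinned 𝔎) (hlaws : 𝔎.Laws) :
    ∀ (L : Type) [Field L] [NumberField L] [IsCMField L] (ι : L →+* ℂ) (H : Matrix (Fin 3) (Fin 3) L) (T : GL (Fin 3) ℂ)
      (hT : (T : Matrix (Fin 3) (Fin 3) ℂ)ᴴ * H.map ι * (T : Matrix (Fin 3) (Fin 3) ℂ) = Literature.Geometry.ComplexHyperbolic.BallModel.J)
      (hdef : ∀ τ' : L →+* ℂ, InfinitePlace.mk τ' ≠ InfinitePlace.mk ι → (H.map τ').PosDef)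
      (h2 : 2 ≤ Module.finrank ℚ ↥(maximalRealSubfield L))
      (μ : Measure (adelicGroupData (↥(maximalRealSubfield L)) L (IsCMField.complexConj L) 3 H).automorphicQuotient)
      [(adelicGroupData (↥(maximalRealSubfield L)) L (IsCMField.complexConj L) 3 H).IsAutomorphicMeasure μ]
      (μω : HeckeCharacter L) (hμu : μω.IsUnitary)
      (hμω : ∀ x : Literature.NumberTheory.GaloisRepresentations.ideleGroup ↥(maximalRealSubfield L),
        μω (AdeleRing.ideleBaseChange (↥(maximalRealSubfield L)) L x) = quadraticHeckeCharCM L x)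
      (W : Type) [AddCommGroup W] [Module ℂ W]
      (σ : Representation ℂ (finAdelic (↥(maximalRealSubfield L)) L (IsCMField.complexConj L) 3 H) W),
      σ.IsSmooth →
      ∀ (P : DiscreteAutomorphicRep (adelicGroupData (↥(maximalRealSubfield L)) L (IsCMField.complexConj L) 3 H) μ),
        (P.IsHolCotangentAt (cmArchSection L ι H T hT) (cmCompactFactor L ι H T hT) ∨
          P.IsAntiholCotangentAt (cmArchSection L ι H T hT) (cmCompactFactor L ι H T hT)) →
        P.HasFinComponent σ →
      ∃ ξ₀ : OneDimAutRepH L,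
        MemXiFamily P (transpose_map_cmConjRingHom_eq_of_frame L ι H T hT) (isUnit_det_of_frame L ι H T hT) μω hμu ξ₀ ∧
        ∀ (v : HeightOneSpectrum (𝓞 ↥(maximalRealSubfield L))) (c : IrrClass ((cmDatum L 3 H).Local v)),
          (IrrClass.comap (localPiEquiv L (IsCMField.complexConj L) 3 H v) c).IsConstituentOf
              (σ.comp (inclPlace (↥(maximalRealSubfield L)) L (IsCMField.complexConj L) 3 H v)) →
          c ∈ ((𝔎 L ι H T hT hdef h2 μ μω hμu hμω).packFin ξ₀ v).members := by
  intro L _ _ _ ι H T hT hdef h2 μ _ μω hμu hμω W _ _ σ hsm P hP hPσ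
  obtain ⟨M, iM₁, iM₂, σK, σ𝔤, hM, δ, hδ, hirrGK, hT₁, hne⟩ :=
    F0P3SLayerFoldShapes.exists_cohToken_of_isHolOrAntihol_cpt L ι H T hT μ hdef h2 P hP
  have hKc : KcTrivial L H ι T hT μ P :=
    fun k hk w => F0P3CompactTrivOfRecord.cmCompactFactor_rightRegular_eq_self_of_isHolOrAntihol L ι H T hT P hP k hk w
  obtain ⟨ξ₀, -, hconst, -, hmem₀⟩ :=
    F0P3APacketMembersOfT5.aPacketMembersGuarded_of_T5 𝔎 hpin hlaws L ι H T hT hdef h2 μ μω hμu hμω P hP hKc M σK σ𝔤 hM hirrGK hT₁ δ hδ hne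
  exact ⟨ξ₀, hmem₀, fun v c hc =>
    hconst v c (F0P3FinRepConstituentsExist.isConstituentOf_finRepSmooth_comp_of_hasFinComponent P hsm hPσ hc)⟩

end Summit.HodgeConjecture.HodgeConjecture.Cruxes.H413.F0P2oD7alphaMemOfT5

end
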